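import Literature.Geometry.Kaehler.HolomorphicChainAddAssemblyProofs
import Literature.Geometry.Kaehler.AnalyticSetHausdorffNull
import Literature.Geometry.Kaehler.HolomorphicChainRectifiable
import HarnessLib

/-!
# Additivity of the current of a holomorphic chain, III: `[T + T'] = [T] + [T']` from Harvey's fact

The named fact `Literature.Geometry.Kaehler.Chirka1989_toCurrent_add` ([Chirka1989, §16.1]:
"each holomorphic `p`-chain `T = Σ kᵢ Aᵢ` … determines a current `Σ kᵢ [Aᵢ]` …; formal sums of the
form `kA − kA` correspond to the current equal to zero") is reduced here to the single named fact
`Literature.Geometry.Kaehler.Harvey1977_isRectifiableData_toCurrent` (the structure of `[T]`: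
measurable carrier and locally integrable density field — Lelong's theorem — for every chain):

* `HolomorphicChain.euclideanHausdorffMeasure_image_inter_eq_zero` — two distinct components of two
  holomorphic `p`-chains on `Ω ⊆ V` meet in an `𝓗^{2p}`-null set (they are distinct irreducible
  analytic sets of pure dimension `p`; `AnalyticSetHausdorffNull.lean`, [Chirka1989, §5.3 Cor. 1,
  §3.7 Cor.]);
* `Chirka1989_toCurrent_add_of_isRectifiableData` — **`Harvey1977_isRectifiableData_toCurrent →
  Chirka1989_toCurrent_add`**, by `HolomorphicChain.toCurrent_add_of_isRectifiableData`
  (`HolomorphicChainAddAssemblyProofs.lean`);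
* `Chirka1989_toCurrent_add_of_lelong` — **`Lelong1957_hausdorffMeasure_inter_lt_top →
  Chirka1989_toCurrent_add`**, composing with `Harvey1977_isRectifiableData_toCurrent_of_lelong`
  (`HolomorphicChainRectifiable.lean`).

The discharge `Chirka1989_toCurrent_add_holds` is thus the one-liner
`Chirka1989_toCurrent_add_of_lelong Lelong1957_hausdorffMeasure_inter_lt_top_holds` once Lelong's
theorem is discharged; without Lelong's theorem additivity cannot be proved for the tree's
encoding, because the current of a chain whose density field is not locally integrable is the junk
value `0` (so a single non-integrable chain `T₀` and a disjoint affine `p`-disc chain `S` would give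
`[(T₀ + S) + (-T₀)] = [S] ≠ 0 = [T₀ + S] + [-T₀]`).

No named facts, no definitions.

## References

* E. M. Chirka, *Complex Analytic Sets*, Kluwer 1989, §3.7 Cor., §5.3 Cor. 1, §14.1, §16.1
  (p. 206) [Chirka1989].
* R. Harvey, *Holomorphic chains and their boundaries*, PSPUM XXX.1 (1977), §2.1 (2.2) [Harvey1977].
-/

open scoped Manifold Topology ENNReal
open Set Filter MeasureTheory

namespace Literature.Geometry.Kaehler

open Literature.Geometry.GeometricMeasureTheory

namespace HolomorphicChain

variable {V : Type*} [NormedAddCommGroup V] [InnerProductSpace ℂ V] [FiniteDimensional ℂ V]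
  [MeasurableSpace V] [BorelSpace V] {Ω : TopologicalSpace.Opens V} {p : ℕ}

/-- **Distinct components of holomorphic `p`-chains meet in an `𝓗^{2p}`-null set**: for chains
`T, T'` on `Ω ⊆ V` and distinct sets `Z ≠ Z'` each of which is a component of `T` or of `T'`
(irreducible analytic of pure dimension `p`), `μHE[2p]` of the image of `Z ∩ Z'` in `V` vanishes.
[cite: Chirka1989, §5.3 Cor. 1, p. 55] -/
theorem euclideanHausdorffMeasure_image_inter_eq_zero (T T' : HolomorphicChain 𝓘(ℂ, V) Ω p)
    {Z Z' : Set Ω} (hne : Z ≠ Z') (hZ : T.mult Z ≠ 0 ∨ T'.mult Z ≠ 0)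
    (hZ' : T.mult Z' ≠ 0 ∨ T'.mult Z' ≠ 0) :
    (μHE[2 * p] : Measure V) ((↑) '' (Z ∩ Z') : Set V) = 0 := by
  have hcomp : ∀ {Y : Set Ω}, (T.mult Y ≠ 0 ∨ T'.mult Y ≠ 0) →
      IsIrreducibleAnalyticSet 𝓘(ℂ, V) Y ∧ HasPureDim 𝓘(ℂ, V) Y p := fun h =>
    h.elim (fun h => ⟨T.isIrreducibleAnalyticSet_of_mult_ne_zero h, T.hasPureDim_of_mult_ne_zero h⟩)
      fun h => ⟨T'.isIrreducibleAnalyticSet_of_mult_ne_zero h, T'.hasPureDim_of_mult_ne_zero h⟩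
  obtain ⟨hZi, c, hc, hZc⟩ := hcomp hZ
  obtain ⟨hZ'i, c', hc', hZ'c⟩ := hcomp hZ'
  obtain rfl : c' = c := by omega
  exact hZi.euclideanHausdorffMeasure_image_inter_eq_zero hZ'i hc hZc hZ'c hne

end HolomorphicChain

universe u

/-- **`[T + T'] = [T] + [T']` from Harvey's structure fact**: the named fact
`Chirka1989_toCurrent_add` ([Chirka1989, §16.1]) follows from
`Harvey1977_isRectifiableData_toCurrent` ([Harvey1977, §2.1 (2.2)], which contains Lelong's
theorem: measurability of the carriers `reg |T|` and local integrability of the density fields of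
all holomorphic chains), by `HolomorphicChain.toCurrent_add_of_isRectifiableData` and the
`𝓗^{2p}`-nullity of the intersections of distinct components
(`HolomorphicChain.euclideanHausdorffMeasure_image_inter_eq_zero`). [cite: Chirka1989, §16.1, p. 206] -/
theorem Chirka1989_toCurrent_add_of_isRectifiableData (h : Harvey1977_isRectifiableData_toCurrent.{u}) :
    Chirka1989_toCurrent_add.{u} := by
  intro V _ _ _ _ _ Ω p T T'
  exact T.toCurrent_add_of_isRectifiableData h T' fun Z Z' hne hZ hZ' =>
    T.euclideanHausdorffMeasure_image_inter_eq_zero T' hne hZ hZ'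

/-- **`[T + T'] = [T] + [T']` from Lelong's theorem**: the named fact `Chirka1989_toCurrent_add`
([Chirka1989, §16.1]) follows from Lelong's theorem `Lelong1957_hausdorffMeasure_inter_lt_top`
([Chirka1989, §14.1 Thm.]) alone, through Harvey's structure fact
(`Harvey1977_isRectifiableData_toCurrent_of_lelong`, [Harvey1977, §2.1 (2.2)]) and
`Chirka1989_toCurrent_add_of_isRectifiableData`. [cite: Chirka1989, §16.1, p. 206] -/
theorem Chirka1989_toCurrent_add_of_lelong (hL : Lelong1957_hausdorffMeasure_inter_lt_top.{u}) :
    Chirka1989_toCurrent_add.{u} :=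
  Chirka1989_toCurrent_add_of_isRectifiableData (Harvey1977_isRectifiableData_toCurrent_of_lelong hL)

end Literature.Geometry.Kaehler
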